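import Summits.QuantumFields.YangMills.Theorems.BalabanLadderNTMarkovMirrorDefectFBL6
import Summits.QuantumFields.YangMills.Theorems.BalabanLadderUVSeamRecFloorsEngineOfReference
import HarnessLib

/-!
# Crux `UVSeamRec` (stmt-QuantumFields-20043), stub `stub_floorsEngine` (v4-F): CHECK-LEMMA — the registered
# statement from the ONE-POINT Markov–mirror package at `rF` (card E, series `BalabanLadderNTMarkovMirror*`)

Helper file (`--supports stmt-QuantumFields-20043`) of the fleet lead prover of crux `UVSeamRec` (unit
`ym-spine-20043-p1`, g6).  Parallel to the 19353 lead's `…FloorsEngineOfReference` (p505548: the reference-package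
press-button), this file exhibits the SECOND landed currency in which the registered floors stub of `UVSeamRec`
(v4-F f523973980851859, `stub_floorsEngine`: compact-witness `Q2`/`|Q3|` floors of `SU(2)` at
`rF = fundamentalLatticeRep 2` in a unit `a` with `a/uRec → c₀ > 0`) is fed: for clause (i), the ONE-POINT
Markov–mirror package of card `markov-mirror-dirichlet-response` —

* ONE compactly supported positive-time test function `v`; per coupling ONE positive-time femto cube `Q_β` (physical
  size `≤ Λ₅`) carrying the lattice support of `v(aβ·)` at depth `≥ 2`, the `e₀`-thickened support at physical
  depth `≥ κ`;
* (RBL+SUP) `|kerE_{Q_β}^ζ(Ṽ_v) − p β + 𝒢_β ζ| ≤ √ε/2` for EVERY exterior `ζ` (refined boundary law: the boundary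
  response of the smeared density is, to relative leading order, a bounded continuous cylinder shell functional
  `𝒢_β` on the closed collar);
* (BL6) `|kerE_{Q_β}^ζ(plane_q x) − p_q β| ≤ C₁/depth⁴` for the electric plane fields at the thickened support
  (femto boundary law, plane-resolved; implied by `FBL6 SU(2) rF a`);
* (SF) `Cov_T(𝒢_β∘Θ₀, 𝒢_β) ≥ 4ε` on every torus `aβ·L ≥ Λ₅` (shell floor) —

together with ANY supplier of the three-point conjunct and the unit clauses.  Then `stubFloorsEngine_of_mirrorPackage_rF`
concludes the REGISTERED statement verbatim (`Transport.uRec`).  Mechanism: `lowerBounds_fst_of_mirrorPackage_fbl6`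
(exact Markov mirror factorisation + reflection positivity + time-chirality identity + defect by parts).
No `UV`, no two-point ceiling, no window, no `∀η` floor is consumed.  Honest status: RBL, BL6, SF and clause (ii) are
engine-grade inputs (card E, category c′); this file proves the bookkeeping only.
-/

set_option autoImplicit false

noncomputable section

open scoped SchwartzMap
open MeasureTheory Filter Topology
open Literature.MathematicalPhysics.QuantumFieldTheory Literature.MathematicalPhysics.QuantumLattice
open Literature.Probability.LatticeModels
open Summit.QuantumFields.YangMills.Cruxes.OSLegsFromFemtoAndGap.DlrCollarTransfer
open Summit.QuantumFields.YangMills.Cruxes.NT.MarkovMirror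

namespace Summit.QuantumFields.YangMills.Cruxes.UVSeamRec.MarkovMirrorFloors

/-- **CHECK-LEMMA: the REGISTERED v4-F `stub_floorsEngine` statement from the one-point Markov–mirror package at
`rF`.**  For `SU(2)` with its Borel σ-algebra: a unit map `a > 0` with `a β / uRec β → c₀ > 0`; for clause (i) the
one-point package of card E at the fundamental lattice representation (module docstring); any supplier of the
compact-witness three-point conjunct.  Then the statement of `stub_floorsEngine` holds (witnesses `a`, `c₀`, the
package's `v`, `ε`). [folklore] -/
theorem stubFloorsEngine_of_mirrorPackage_rF
    (h : letI : MeasurableSpace (Matrix.specialUnitaryGroup (Fin 2) ℂ) := borel _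
      haveI : BorelSpace (Matrix.specialUnitaryGroup (Fin 2) ℂ) := ⟨rfl⟩
      ∃ (a : ℝ → ℝ) (c₀ : ℝ), 0 < c₀ ∧ (∀ β, 0 < a β) ∧
        Tendsto (fun β => a β / Transport.uRec β) atTop (𝓝 c₀) ∧
      (∃ (v : 𝓢(EuclideanSpace ℝ (Fin 4), ℝ)) (ε β₅ Λ₅ κ C₁ : ℝ) (c : ℝ → (Fin 4 → ℤ)) (b : ℝ → ℕ)
          (p : ℝ → ℝ) (p6 : ℝ → {q : Fin 4 × Fin 4 // q.1 < q.2} → ℝ)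
          (𝒢 : ℝ → LGConfig 4 (Matrix.specialUnitaryGroup (Fin 2) ℂ) → ℝ),
          HasCompactSupport (v : EuclideanSpace ℝ (Fin 4) → ℝ) ∧
          tsupport (v : EuclideanSpace ℝ (Fin 4) → ℝ) ⊆ {y | 0 < y 0} ∧ 0 < ε ∧ 0 < κ ∧ 0 ≤ C₁ ∧
          (∀ β, β₅ ≤ β → 1 ≤ c β 0 ∧ ∀ j : Fin 4, (|((c β j : ℤ) : ℝ)| + (b β : ℝ) + 3) * a β ≤ Λ₅) ∧
          (∀ β, β₅ ≤ β → ∀ x : Fin 4 → ℤ, v (a β • siteToE x) ≠ 0 →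
            x ∈ cubeSites (c β) (b β) ∧ 2 ≤ depth (c β) (b β) x) ∧
          (∀ β, β₅ ≤ β → ∀ x : Fin 4 → ℤ,
            (v (a β • siteToE x) ≠ 0 ∨ v (a β • siteToE (x + Pi.single 0 1)) ≠ 0) →
              x ∈ cubeSites (c β) (b β) ∧ κ / a β ≤ (depth (c β) (b β) x : ℝ)) ∧
          (∀ β, β₅ ≤ β → Continuous (𝒢 β) ∧ (∃ M : ℝ, ∀ U, |𝒢 β U| ≤ M) ∧
            ∃ S : Finset (Literature.MathematicalPhysics.QuantumLattice.ZdEdge 4), IsCylinder (𝒢 β) S ∧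
              ∀ e ∈ S, ∀ j, c β j - 1 ≤ e.1 j ∧ e.1 j ≤ c β j + b β + 1) ∧
          (∀ β, β₅ ≤ β → ∀ ζ,
            |kerE (Matrix.specialUnitaryGroup (Fin 2) ℂ) (fundamentalLatticeRep 2) β (c β) (b β) ζ
                (fun V => ∑ y ∈ cubeSites (c β) (b β), v (a β • siteToE y) *
                  dens (Matrix.specialUnitaryGroup (Fin 2) ℂ) (fundamentalLatticeRep 2) y V) -
              p β + 𝒢 β ζ| ≤ Real.sqrt ε / 2) ∧
          (∀ β, β₅ ≤ β → ∀ (ζ : LGConfig 4 (Matrix.specialUnitaryGroup (Fin 2) ℂ))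
            (q : {q : Fin 4 × Fin 4 // q.1 < q.2}), q.1.1 = 0 → ∀ x ∈ cubeSites (c β) (b β),
              (v (a β • siteToE x) ≠ 0 ∨ v (a β • siteToE (x + Pi.single 0 1)) ≠ 0) →
                |kerE (Matrix.specialUnitaryGroup (Fin 2) ℂ) (fundamentalLatticeRep 2) β (c β) (b β) ζ
                    (plane (Matrix.specialUnitaryGroup (Fin 2) ℂ) (fundamentalLatticeRep 2) q.1 x) - p6 β q| ≤
                  C₁ / (depth (c β) (b β) x : ℝ) ^ 4) ∧
          (∀ β, β₅ ≤ β → ∀ L : ℕ, Λ₅ ≤ a β * L →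
            4 * ε ≤ torusE (Matrix.specialUnitaryGroup (Fin 2) ℂ) (fundamentalLatticeRep 2) β L
                (fun V => 𝒢 β (cfgReflect V) * 𝒢 β V) -
              torusE (Matrix.specialUnitaryGroup (Fin 2) ℂ) (fundamentalLatticeRep 2) β L (fun V => 𝒢 β (cfgReflect V)) *
                torusE (Matrix.specialUnitaryGroup (Fin 2) ℂ) (fundamentalLatticeRep 2) β L (𝒢 β))) ∧
      (∃ (f g h : 𝓢(EuclideanSpace ℝ (Fin 4), ℝ)) (ε β₅ Λ₅ : ℝ),
        HasCompactSupport (f : EuclideanSpace ℝ (Fin 4) → ℝ) ∧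
        HasCompactSupport (g : EuclideanSpace ℝ (Fin 4) → ℝ) ∧
        HasCompactSupport (h : EuclideanSpace ℝ (Fin 4) → ℝ) ∧
        Disjoint (tsupport (f : EuclideanSpace ℝ (Fin 4) → ℝ)) (tsupport (g : EuclideanSpace ℝ (Fin 4) → ℝ)) ∧
        Disjoint (tsupport (g : EuclideanSpace ℝ (Fin 4) → ℝ)) (tsupport (h : EuclideanSpace ℝ (Fin 4) → ℝ)) ∧
        Disjoint (tsupport (f : EuclideanSpace ℝ (Fin 4) → ℝ)) (tsupport (h : EuclideanSpace ℝ (Fin 4) → ℝ)) ∧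
        0 < ε ∧ ∀ β : ℝ, β₅ ≤ β → ∀ L : ℕ, Λ₅ ≤ a β * L →
          ε ≤ |Q3 (Matrix.specialUnitaryGroup (Fin 2) ℂ) (fundamentalLatticeRep 2) β L (a β) f g h|)) :
    letI : MeasurableSpace (Matrix.specialUnitaryGroup (Fin 2) ℂ) := borel _
    haveI : BorelSpace (Matrix.specialUnitaryGroup (Fin 2) ℂ) := ⟨rfl⟩
    ∃ (a : ℝ → ℝ) (c₀ : ℝ), 0 < c₀ ∧ (∀ β, 0 < a β) ∧
      Tendsto (fun β => a β / Transport.uRec β) atTop (𝓝 c₀) ∧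
      (∃ (v : 𝓢(EuclideanSpace ℝ (Fin 4), ℝ)) (ε β₅ Λ₅ : ℝ),
        HasCompactSupport (v : EuclideanSpace ℝ (Fin 4) → ℝ) ∧
        tsupport (v : EuclideanSpace ℝ (Fin 4) → ℝ) ⊆ {y : EuclideanSpace ℝ (Fin 4) | 0 < y 0} ∧ 0 < ε ∧
        ∀ β : ℝ, β₅ ≤ β → ∀ L : ℕ, Λ₅ ≤ a β * L →
          ε ≤ Q2 (Matrix.specialUnitaryGroup (Fin 2) ℂ) (fundamentalLatticeRep 2) β L (a β) (thetaTest 4 v) v) ∧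
      (∃ (f g h : 𝓢(EuclideanSpace ℝ (Fin 4), ℝ)) (ε β₅ Λ₅ : ℝ),
        HasCompactSupport (f : EuclideanSpace ℝ (Fin 4) → ℝ) ∧
        HasCompactSupport (g : EuclideanSpace ℝ (Fin 4) → ℝ) ∧
        HasCompactSupport (h : EuclideanSpace ℝ (Fin 4) → ℝ) ∧
        Disjoint (tsupport (f : EuclideanSpace ℝ (Fin 4) → ℝ)) (tsupport (g : EuclideanSpace ℝ (Fin 4) → ℝ)) ∧
        Disjoint (tsupport (g : EuclideanSpace ℝ (Fin 4) → ℝ)) (tsupport (h : EuclideanSpace ℝ (Fin 4) → ℝ)) ∧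
        Disjoint (tsupport (f : EuclideanSpace ℝ (Fin 4) → ℝ)) (tsupport (h : EuclideanSpace ℝ (Fin 4) → ℝ)) ∧
        0 < ε ∧ ∀ β : ℝ, β₅ ≤ β → ∀ L : ℕ, Λ₅ ≤ a β * L →
          ε ≤ |Q3 (Matrix.specialUnitaryGroup (Fin 2) ℂ) (fundamentalLatticeRep 2) β L (a β) f g h|) := by
  letI : MeasurableSpace (Matrix.specialUnitaryGroup (Fin 2) ℂ) := borel _
  haveI : BorelSpace (Matrix.specialUnitaryGroup (Fin 2) ℂ) := ⟨rfl⟩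
  obtain ⟨a, c₀, hc₀, ha₀, hau, ⟨v, ε, β₅, Λ₅, κ, C₁, c, b, p, p6, 𝒢, hvK, hv, hε, hκ, hC₁, hgeom, hsupp, hthick,
    h𝒢, hRBL, hBL, hSF⟩, h3⟩ := h
  have ha : Tendsto a atTop (𝓝 0) := ReferenceFloors.tendsto_zero_of_ratio hau
  -- (RBLΔ) from the boundary law, eventually
  have hη : 0 < Real.sqrt ε / 2 := by positivity
  obtain ⟨β₆, hΔ⟩ := defect_response_eventually_le (Matrix.specialUnitaryGroup (Fin 2) ℂ) (fundamentalLatticeRep 2)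
    a ha₀ ha v hvK hκ hC₁ c b p6 hsupp hthick hBL hη
  -- the two-point floor for the SAME `v`, from the chiral package restricted to `β ≥ max β₅ β₆`
  have key := Q2_floor_of_mirrorPackage_chiral (Matrix.specialUnitaryGroup (Fin 2) ℂ) (fundamentalLatticeRep 2) a ha₀ v
    hε (β₅ := max β₅ β₆) (Λ₅ := Λ₅) c b p
    (fun β => ∑ x ∈ cubeSites (c β) (b β), (v (a β • siteToE (x + Pi.single 0 1)) - v (a β • siteToE x)) *
      ∑ q : {q : Fin 4 × Fin 4 // q.1 < q.2}, (if q.1.1 = 0 then p6 β q else 0)) 𝒢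
    (fun β hβ => hgeom β (le_trans (le_max_left _ _) hβ))
    (fun β hβ => hsupp β (le_trans (le_max_left _ _) hβ))
    (fun β hβ => h𝒢 β (le_trans (le_max_left _ _) hβ))
    (fun β hβ => hRBL β (le_trans (le_max_left _ _) hβ))
    (fun β hβ ζ => hΔ β (le_trans (le_max_right _ _) hβ) ζ)
    (fun β hβ => hSF β (le_trans (le_max_left _ _) hβ))
  exact ⟨a, c₀, hc₀, ha₀, hau, ⟨v, ε, max (max β₅ β₆) 0, Λ₅, hvK, hv, hε, key⟩, h3⟩

end Summit.QuantumFields.YangMills.Cruxes.UVSeamRec.MarkovMirrorFloors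

end
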